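import Summits.KontsevichZagierPeriods.KontsevichZagierPeriods.Theorems.SymplecticScissorsRealOnePeriodRelationsStubTransferTors
import Summits.KontsevichZagierPeriods.KontsevichZagierPeriods.Theorems.SymplecticScissorsRealOnePeriodRelationsIsoLayer

/-!
# Crux `RealOnePeriodRelations` (stmt-KontsevichZagierPeriods-10042), line `nash-retraction-thin-strip`, reshape 10 (lead c8):
# THE TORSION (THIRD-KIND) LAYER OF THE CRUX, UNCONDITIONALLY

A new SECTOR of the apex `HuberWustholzCurvePeriods` by pure transfer, and its real clothes:

* `huberWustholzCurvePeriods_torsionPunctured` — **Huber–Wüstholz, Theorem 13.3 (2), for the TORSION-PUNCTURED affine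
  Weierstrass curves** `C_T = {y² = x³ + Ax + B, w · ∏_{a ∈ T}(x − a) = 1}` (the `a ∈ T` abscissae of torsion points of a
  non-CM `E_L`) together with `E_L`, the punctured lines, `𝔾ₘ` and `𝔸¹` — arbitrary paths and ARBITRARY forms on `C_T`,
  i.e. incomplete elliptic integrals of the first, second AND THIRD kind with torsion residue divisor.  Every symbol on `C_T`
  is elementary-equivalent to symbols on `E_L ∪ 𝔾ₘ ∪ 𝔸¹` (`stub_transferTors`: de Rham reduction `stub_formReductionP`, and
  for the third-kind classes `ξ_t = dx/((x − t)y)` the torsion units `G_±` of divisor `N(±P) − N(O)` — `stub_torsUnit`, built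
  WITHOUT divisor theory from `stub_torsPolyExists` (linear algebra over `ℚ̄`) and `stub_ellipticLiouville` (a `Λ`-periodic
  meromorphic function with at most one simple pole per period class is constant) — give
  `N ℘′(v)/2 · ξ_t = ½ (dlog G₊ − dlog G₋) + λ θ₀`, so `ξ_t`-periods are logarithms of algebraic numbers plus first-kind
  periods); then the tree's proved elliptic-paths sector applies.  No new transcendence input.
* `realOnePeriodRelations_torsionLayer` — **the torsion layer of the crux**: every `ℤ`-combination with vanishing value of
  rational representations, first/second-kind elliptic cells and tails on a real non-CM Weierstrass curve `E_{A,B}`, and TORSION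
  CELLS `∫_a^b P(x) dx/(∏ᵢ (x − cᵢ)^{mᵢ} √(x³ + Ax + B))` with real torsion abscissae `cᵢ ∉ [a, b]` lies in
  `M₁ = closure (1a ∪ 1b ∪ 2 ∪ Green)` (`SectorGlue.realOnePeriodRelations_of_sector` with `torsCells`, `torsLayerArcs` —
  the latter from `stub_torsArcs` — and the sector theorem).

[cite: HuberWustholz2022, Thm 13.3 (2), §13.1 (B), §13.2, §18.1] [cite: KontsevichZagier2001, §1.2]
[cite: WhittakerWatson1927, §20.53] [cite: SilvermanAEC2009, III.3.5]
-/

noncomputable section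

open scoped BigOperators Topology Polynomial PeriodPair
open Set Filter MeasureTheory MvPolynomial Complex
open Literature.NumberTheory.Transcendental Literature.NumberTheory.Transcendental.CurvePeriods
open Literature.NumberTheory.Transcendental.CurvePeriods.Ell
open Summit.KontsevichZagierPeriods.SymplecticScissors.RealOnePeriodRelationsNegative (M₁ H₁)

namespace Summit.KontsevichZagierPeriods.SymplecticScissors.RealOnePeriodRelations

namespace TorsionLayer

variable (L : PeriodPair)

/-! ## The torsion-punctured SECTOR of the apex (proved modulo `stub_transferTors`) -/

/-- Torsion abscissae are algebraic. [folklore] -/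
theorem isAlgebraic_of_torsionAbscissa : ∀ (L : PeriodPair) {T : Finset ℂ}, (∀ a ∈ T, ∃ v : ℂ, IsAlgPt L v ∧ (∃ n : ℕ, 1 ≤ n ∧ (n : ℂ) * v ∈ L.lattice) ∧ ℘[L] v = a) → ∀ a ∈ T, IsAlgebraic ℚ a := by
  intro L T hT a ha
  obtain ⟨v, hv, -, rfl⟩ := hT a ha
  exact hv.weierstrassP

/-- **Huber–Wüstholz, Theorem 13.3 (2), for the TORSION-PUNCTURED affine Weierstrass curves `C_T` of a non-CM lattice
together with `E_L`, the punctured lines, `𝔾ₘ` and `𝔸¹` — arbitrary paths, arbitrary forms (first, second and THIRD kind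
with torsion residue divisor).**  Every symbol on `C_T` is transferred to `E_L ∪ 𝔾ₘ ∪ 𝔸¹` (`stub_transferTors`), then the
tree's proved elliptic-paths sector `huberWustholzCurvePeriods_ellipticPaths_puncturedLine` applies.
[cite: HuberWustholz2022, Thm 13.3 (2), §13.1 (B), §13.2] -/
theorem huberWustholzCurvePeriods_torsionPunctured (h₂ : IsAlgebraic ℚ L.g₂) (h₃ : IsAlgebraic ℚ L.g₃)
    (hCM : ¬ L.HasCM) (c : PeriodSymbol →₀ ℂ) (hc : ∀ s, IsAlgebraic ℚ (c s))
    (hsupp : ∀ s ∈ c.support,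
      (∃ T : Finset ℂ, (∀ a ∈ T, ∃ v : ℂ, IsAlgPt L v ∧ (∃ n : ℕ, 1 ≤ n ∧ (n : ℂ) * v ∈ L.lattice) ∧ ℘[L] v = a) ∧
        s.Z = curveP L T) ∨
      (∃ (r : ℕ) (a : Fin r → ℂ), Function.Injective a ∧ (∀ i, IsAlgebraic ℚ (a i)) ∧
        s.Z = (⟨2, 1, ![X 1 * ∏ i, (X 0 - C (a i)) - 1]⟩ : CurveData)) ∨
      s.Z = curve L ∨ s.Z = (⟨2, 1, ![X 0 * X 1 - 1]⟩ : CurveData) ∨ s.Z = CurveData.affineLine)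
    (h0 : evalCombination c = 0) :
    ∃ (k : ℕ) (ρ : Fin k → (PeriodSymbol →₀ ℂ)) (a : Fin k → ℂ),
      (∀ l, IsElementaryRelation (ρ l)) ∧ (∀ l, IsAlgebraic ℚ (a l)) ∧ c = ∑ l, a l • ρ l := by
  classical
  have key : ∀ s : PeriodSymbol, ∃ V : PeriodSymbol →₀ ℂ, s ∈ c.support →
      ((∀ t, IsAlgebraic ℚ (V t)) ∧ (∃ (k : ℕ) (ρ : Fin k → (PeriodSymbol →₀ ℂ)) (a : Fin k → ℂ),
      (∀ l, IsElementaryRelation (ρ l)) ∧ (∀ l, IsAlgebraic ℚ (a l)) ∧ (Finsupp.single s 1 - V) = ∑ l, a l • ρ l) ∧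
        (∀ t ∈ V.support,
          (∃ (r : ℕ) (a : Fin r → ℂ), Function.Injective a ∧ (∀ i, IsAlgebraic ℚ (a i)) ∧
            t.Z = (⟨2, 1, ![X 1 * ∏ i, (X 0 - C (a i)) - 1]⟩ : CurveData)) ∨
          t.Z = Ell.curve L ∨ t.Z = (⟨2, 1, ![X 0 * X 1 - 1]⟩ : CurveData) ∨ t.Z = CurveData.affineLine)) := by
    intro s
    by_cases hs : s ∈ c.support
    · rcases hsupp s hs with ⟨T, hT, hsZ⟩ | hrest
      · obtain ⟨Z, hZ, ω, hω, γ⟩ := s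
        dsimp only at hsZ
        subst hsZ
        have hTalg := isAlgebraic_of_torsionAbscissa L hT
        obtain rfl : hZ = smoothP L h₂ h₃ hTalg := rfl
        obtain ⟨V, hValg, hVrel, hVsupp⟩ := stub_transferTors L h₂ h₃ T hT hTalg ω hω γ
        exact ⟨V, fun _ => ⟨hValg, hVrel, fun t ht => Or.inr (hVsupp t ht)⟩⟩
      · exact ⟨Finsupp.single s 1, fun _ => ⟨fun t => isAlgebraic_single_one_apply _ _,
          by rw [sub_self]; exact span_zero, fun t ht => by
            have h3 := (Finsupp.mem_support_single _ _ _).1 ht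
            rw [h3.1]
            exact hrest⟩⟩
    · exact ⟨0, fun h => (hs h).elim⟩
  choose V hV using key
  exact span_of_transfer_finsupp c hc V (fun s hs => (hV s hs).1) (fun s hs => (hV s hs).2.1)
    (fun t => (∃ (r : ℕ) (a : Fin r → ℂ), Function.Injective a ∧ (∀ i, IsAlgebraic ℚ (a i)) ∧
        t.Z = (⟨2, 1, ![X 1 * ∏ i, (X 0 - C (a i)) - 1]⟩ : CurveData)) ∨
      t.Z = Ell.curve L ∨ t.Z = (⟨2, 1, ![X 0 * X 1 - 1]⟩ : CurveData) ∨ t.Z = CurveData.affineLine)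
    (fun s hs => (hV s hs).2.2)
    (fun c' hc' hsupp' h0' => huberWustholzCurvePeriods_ellipticPaths_puncturedLine L h₂ h₃ hCM c' hc' hsupp' h0') h0


/-! ## The real clothes: cells, arcs and THE TORSION LAYER OF THE CRUX -/

section Layer

variable {L}

/-- CELLS of the torsion layer: rational representations by `stub_ratCells`, elliptic cells and tails by `ellCells`, torsion
cells as they stand. [cite: KontsevichZagier2001, §1.2] -/
theorem torsCells (A B : ℝ) (hA : IsAlgebraic ℚ A) (hB : IsAlgebraic ℚ B) (M : PeriodPair) :
    ∀ c : KZ.FormalRep, c ∈ AddSubgroup.closure ((fun r : KZ.IntegralRep 1 => KZ.of r) ''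
      {r | r.IsRational ∨
        (∃ a b : ℝ, IsAlgebraic ℚ a ∧ IsAlgebraic ℚ b ∧ a < b ∧ r.domain = {z | z 0 ∈ Set.Ioo a b} ∧
          (∀ x ∈ Set.Ioo a b, 0 < x ^ 3 + A * x + B) ∧
          ∃ P₁ P₂ P₃ : Polynomial (algebraicClosure ℚ ℝ), ∀ x ∈ Set.Ioo a b,
            r.integrand (fun _ => x) = Polynomial.aeval x P₁ + Polynomial.aeval x P₂ * Real.sqrt (x ^ 3 + A * x + B) +
              Polynomial.aeval x P₃ / Real.sqrt (x ^ 3 + A * x + B)) ∨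
        (∃ e M' c₀ : ℝ, IsAlgebraic ℚ e ∧ IsAlgebraic ℚ M' ∧ IsAlgebraic ℚ c₀ ∧ e ^ 3 + A * e + B = 0 ∧
          0 < 3 * e ^ 2 + A ∧ e < M' ∧ (∀ x : ℝ, e < x → 0 < x ^ 3 + A * x + B) ∧ r.domain = {z | M' < z 0} ∧
          ∀ z ∈ r.domain, r.integrand z = c₀ / Real.sqrt ((z 0) ^ 3 + A * (z 0) + B)) ∨
        (∃ a b : ℝ, IsAlgebraic ℚ a ∧ IsAlgebraic ℚ b ∧ a < b ∧ r.domain = {z | z 0 ∈ Set.Ioo a b} ∧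
          (∀ x ∈ Set.Ioo a b, 0 < x ^ 3 + A * x + B) ∧
          ∃ (k : ℕ) (c : Fin k → ℝ) (m : Fin k → ℕ) (P : Polynomial (algebraicClosure ℚ ℝ)),
            (∀ i, IsAlgebraic ℚ (c i)) ∧ (∀ i, c i ∉ Set.Icc a b) ∧
            (∀ i, ∃ v : ℂ, v ∉ M.lattice ∧ (∃ n : ℕ, 1 ≤ n ∧ (n : ℂ) * v ∈ M.lattice) ∧ ℘[M] v = (c i : ℂ)) ∧
            ∀ x ∈ Set.Ioo a b, r.integrand (fun _ => x) =
              Polynomial.aeval x P / ((∏ i, (x - c i) ^ m i) * Real.sqrt (x ^ 3 + A * x + B)))}) →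
    ∃ N : KZ.IntegralRep 1 →₀ ℤ, (∀ ρ ∈ N.support,
      (ρ.domain = {z | z 0 ∈ Set.Ioo (0 : ℝ) 1} ∧
          ∃ P Q : Polynomial (algebraicClosure ℚ ℝ),
            (∀ t ∈ Set.Ioo (0 : ℝ) 1, Polynomial.aeval t Q ≠ 0) ∧
            ∀ t ∈ Set.Ioo (0 : ℝ) 1, ρ.integrand (fun _ => t) = Polynomial.aeval t P / Polynomial.aeval t Q) ∨
        (∃ a b : ℝ, IsAlgebraic ℚ a ∧ IsAlgebraic ℚ b ∧ a < b ∧ ρ.domain = {z | z 0 ∈ Set.Ioo a b} ∧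
          (∀ x ∈ Set.Ioo a b, 0 < x ^ 3 + A * x + B) ∧
          ∃ P₁ P₂ P₃ : Polynomial (algebraicClosure ℚ ℝ), ∀ x ∈ Set.Ioo a b,
            ρ.integrand (fun _ => x) = Polynomial.aeval x P₁ + Polynomial.aeval x P₂ * Real.sqrt (x ^ 3 + A * x + B) +
              Polynomial.aeval x P₃ / Real.sqrt (x ^ 3 + A * x + B)) ∨
        (∃ a b : ℝ, IsAlgebraic ℚ a ∧ IsAlgebraic ℚ b ∧ a < b ∧ ρ.domain = {z | z 0 ∈ Set.Ioo a b} ∧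
          (∀ x ∈ Set.Ioo a b, 0 < x ^ 3 + A * x + B) ∧
          ∃ (k : ℕ) (c : Fin k → ℝ) (m : Fin k → ℕ) (P : Polynomial (algebraicClosure ℚ ℝ)),
            (∀ i, IsAlgebraic ℚ (c i)) ∧ (∀ i, c i ∉ Set.Icc a b) ∧
            (∀ i, ∃ v : ℂ, v ∉ M.lattice ∧ (∃ n : ℕ, 1 ≤ n ∧ (n : ℂ) * v ∈ M.lattice) ∧ ℘[M] v = (c i : ℂ)) ∧
            ∀ x ∈ Set.Ioo a b, ρ.integrand (fun _ => x) =
              Polynomial.aeval x P / ((∏ i, (x - c i) ^ m i) * Real.sqrt (x ^ 3 + A * x + B)))) ∧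
      c - N.sum (fun ρ m => m • KZ.of ρ) ∈ M₁ := by
  classical
  intro c hc
  refine AddSubgroup.closure_induction (p := fun c _ => ∃ N : KZ.IntegralRep 1 →₀ ℤ, (∀ ρ ∈ N.support,
      (ρ.domain = {z | z 0 ∈ Set.Ioo (0 : ℝ) 1} ∧
          ∃ P Q : Polynomial (algebraicClosure ℚ ℝ),
            (∀ t ∈ Set.Ioo (0 : ℝ) 1, Polynomial.aeval t Q ≠ 0) ∧
            ∀ t ∈ Set.Ioo (0 : ℝ) 1, ρ.integrand (fun _ => t) = Polynomial.aeval t P / Polynomial.aeval t Q) ∨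
        (∃ a b : ℝ, IsAlgebraic ℚ a ∧ IsAlgebraic ℚ b ∧ a < b ∧ ρ.domain = {z | z 0 ∈ Set.Ioo a b} ∧
          (∀ x ∈ Set.Ioo a b, 0 < x ^ 3 + A * x + B) ∧
          ∃ P₁ P₂ P₃ : Polynomial (algebraicClosure ℚ ℝ), ∀ x ∈ Set.Ioo a b,
            ρ.integrand (fun _ => x) = Polynomial.aeval x P₁ + Polynomial.aeval x P₂ * Real.sqrt (x ^ 3 + A * x + B) +
              Polynomial.aeval x P₃ / Real.sqrt (x ^ 3 + A * x + B)) ∨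
        (∃ a b : ℝ, IsAlgebraic ℚ a ∧ IsAlgebraic ℚ b ∧ a < b ∧ ρ.domain = {z | z 0 ∈ Set.Ioo a b} ∧
          (∀ x ∈ Set.Ioo a b, 0 < x ^ 3 + A * x + B) ∧
          ∃ (k : ℕ) (c : Fin k → ℝ) (m : Fin k → ℕ) (P : Polynomial (algebraicClosure ℚ ℝ)),
            (∀ i, IsAlgebraic ℚ (c i)) ∧ (∀ i, c i ∉ Set.Icc a b) ∧
            (∀ i, ∃ v : ℂ, v ∉ M.lattice ∧ (∃ n : ℕ, 1 ≤ n ∧ (n : ℂ) * v ∈ M.lattice) ∧ ℘[M] v = (c i : ℂ)) ∧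
            ∀ x ∈ Set.Ioo a b, ρ.integrand (fun _ => x) =
              Polynomial.aeval x P / ((∏ i, (x - c i) ^ m i) * Real.sqrt (x ^ 3 + A * x + B)))) ∧
      c - N.sum (fun ρ m => m • KZ.of ρ) ∈ M₁) ?_ ?_ ?_ ?_ hc
  · -- generators
    rintro _ ⟨r, hr, rfl⟩
    rcases hr with hrat | hcell | htail | htors
    · obtain ⟨N, hN, hrN⟩ := EllipticLayer.ellCells A B hA hB (KZ.of r)
        (AddSubgroup.subset_closure ⟨r, Or.inl hrat, rfl⟩)
      exact ⟨N, fun ρ hρ => (hN ρ hρ).elim Or.inl (fun h => Or.inr (Or.inl h)), hrN⟩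
    · obtain ⟨N, hN, hrN⟩ := EllipticLayer.ellCells A B hA hB (KZ.of r)
        (AddSubgroup.subset_closure ⟨r, Or.inr (Or.inl hcell), rfl⟩)
      exact ⟨N, fun ρ hρ => (hN ρ hρ).elim Or.inl (fun h => Or.inr (Or.inl h)), hrN⟩
    · obtain ⟨N, hN, hrN⟩ := EllipticLayer.ellCells A B hA hB (KZ.of r)
        (AddSubgroup.subset_closure ⟨r, Or.inr (Or.inr htail), rfl⟩)
      exact ⟨N, fun ρ hρ => (hN ρ hρ).elim Or.inl (fun h => Or.inr (Or.inl h)), hrN⟩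
    · refine ⟨Finsupp.single r 1, fun ρ hρ => ?_, ?_⟩
      · rw [Finsupp.support_single _ one_ne_zero, Finset.mem_singleton] at hρ
        subst hρ
        exact Or.inr (Or.inr htors)
      · rw [Finsupp.sum_single_index (zero_zsmul _), one_zsmul, sub_self]
        exact M₁.zero_mem
  · exact ⟨0, by simp, by simp [M₁.zero_mem]⟩
  · rintro c c' _ _ ⟨N, hN, hcN⟩ ⟨N', hN', hcN'⟩
    refine ⟨N + N', fun ρ hρ => ?_, ?_⟩
    · rcases Finset.mem_union.mp (Finsupp.support_add hρ) with h | h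
      · exact hN ρ h
      · exact hN' ρ h
    · rw [Cells.combo_add]
      convert M₁.add_mem hcN hcN' using 1
      abel
  · rintro c _ ⟨N, hN, hcN⟩
    refine ⟨-N, fun ρ hρ => hN ρ (by simpa [Finsupp.support_neg] using hρ), ?_⟩
    rw [Cells.combo_neg]
    convert M₁.neg_mem hcN using 1
    abel

/-- ARCS of the torsion layer: punctured-line symbols on unit rational cells, `ellArcs` on elliptic cells, `stub_torsArcs` on
torsion cells. [cite: HuberWustholz2022, §3.3.1] -/
theorem torsLayerArcs (A B : ℝ) (hA : IsAlgebraic ℚ A) (hB : IsAlgebraic ℚ B) (hD : 4 * A ^ 3 + 27 * B ^ 2 ≠ 0)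
    (M : PeriodPair) (hM₂ : M.g₂ = -4 * (A : ℂ)) (hM₃ : M.g₃ = -4 * (B : ℂ)) :
    ∀ ρ : KZ.IntegralRep 1,
    ((ρ.domain = {z | z 0 ∈ Set.Ioo (0 : ℝ) 1} ∧
          ∃ P Q : Polynomial (algebraicClosure ℚ ℝ),
            (∀ t ∈ Set.Ioo (0 : ℝ) 1, Polynomial.aeval t Q ≠ 0) ∧
            ∀ t ∈ Set.Ioo (0 : ℝ) 1, ρ.integrand (fun _ => t) = Polynomial.aeval t P / Polynomial.aeval t Q) ∨
        (∃ a b : ℝ, IsAlgebraic ℚ a ∧ IsAlgebraic ℚ b ∧ a < b ∧ ρ.domain = {z | z 0 ∈ Set.Ioo a b} ∧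
          (∀ x ∈ Set.Ioo a b, 0 < x ^ 3 + A * x + B) ∧
          ∃ P₁ P₂ P₃ : Polynomial (algebraicClosure ℚ ℝ), ∀ x ∈ Set.Ioo a b,
            ρ.integrand (fun _ => x) = Polynomial.aeval x P₁ + Polynomial.aeval x P₂ * Real.sqrt (x ^ 3 + A * x + B) +
              Polynomial.aeval x P₃ / Real.sqrt (x ^ 3 + A * x + B)) ∨
        (∃ a b : ℝ, IsAlgebraic ℚ a ∧ IsAlgebraic ℚ b ∧ a < b ∧ ρ.domain = {z | z 0 ∈ Set.Ioo a b} ∧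
          (∀ x ∈ Set.Ioo a b, 0 < x ^ 3 + A * x + B) ∧
          ∃ (k : ℕ) (c : Fin k → ℝ) (m : Fin k → ℕ) (P : Polynomial (algebraicClosure ℚ ℝ)),
            (∀ i, IsAlgebraic ℚ (c i)) ∧ (∀ i, c i ∉ Set.Icc a b) ∧
            (∀ i, ∃ v : ℂ, v ∉ M.lattice ∧ (∃ n : ℕ, 1 ≤ n ∧ (n : ℂ) * v ∈ M.lattice) ∧ ℘[M] v = (c i : ℂ)) ∧
            ∀ x ∈ Set.Ioo a b, ρ.integrand (fun _ => x) =
              Polynomial.aeval x P / ((∏ i, (x - c i) ^ m i) * Real.sqrt (x ^ 3 + A * x + B)))) →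
    ∃ (C : PeriodSymbol →₀ ℂ) (R : PeriodSymbol → KZ.IntegralRep 1), (∀ s, IsAlgebraic ℚ (C s)) ∧
      (∀ s ∈ C.support,
        (∃ T : Finset ℂ, (∀ a ∈ T, ∃ v : ℂ, IsAlgPt M v ∧ (∃ n : ℕ, 1 ≤ n ∧ (n : ℂ) * v ∈ M.lattice) ∧ ℘[M] v = a) ∧
          s.Z = curveP M T) ∨
        (∃ (r : ℕ) (a : Fin r → ℂ), Function.Injective a ∧ (∀ i, IsAlgebraic ℚ (a i)) ∧
          s.Z = (⟨2, 1, ![X 1 * ∏ i, (X 0 - MvPolynomial.C (a i)) - 1]⟩ : CurveData)) ∨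
        s.Z = weierCurve (A : ℂ) (B : ℂ)) ∧
      (∀ s ∈ C.support, IsSemialgebraicMapOn ℚ {z : Fin 1 → ℝ | z 0 ∈ Set.Icc (0 : ℝ) 1}
        (fun z => Fin.append (fun i => (s.γ.toFun (z 0) i).re) (fun i => (s.γ.toFun (z 0) i).im))) ∧
      (∀ s ∈ C.support, (R s).domain = {z | z 0 ∈ Set.Ioo (0 : ℝ) 1} ∧ ∀ z ∈ (R s).domain, (R s).integrand z =
        (C s * ∑ i, MvPolynomial.eval (s.γ.toFun (z 0)) (s.ω i) * deriv (fun u => s.γ.toFun u i) (z 0)).re) ∧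
      evalCombination C = ((ρ.value : ℝ) : ℂ) ∧ KZ.of ρ - ∑ s ∈ C.support, KZ.of (R s) ∈ M₁ := by
  rintro ρ (hrat | hcell | htors)
  · obtain ⟨C, R, h1, h2, h3, h4, h5, h6⟩ := EllipticLayer.ellLayerArcs A B hA hB hD ρ (Or.inl hrat)
    exact ⟨C, R, h1, fun s hs => Or.inr (h2 s hs), h3, h4, h5, h6⟩
  · obtain ⟨C, R, h1, h2, h3, h4, h5, h6⟩ := EllipticLayer.ellLayerArcs A B hA hB hD ρ (Or.inr hcell)
    exact ⟨C, R, h1, fun s hs => Or.inr (h2 s hs), h3, h4, h5, h6⟩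
  · obtain ⟨C, R, h1, h2, h3, h4, h5, h6⟩ := stub_torsArcs A B hA hB hD M hM₂ hM₃ ρ htors
    exact ⟨C, R, h1, fun s hs => Or.inl (h2 s hs), h3, h4, h5, h6⟩

/-- **THE TORSION (THIRD-KIND) LAYER OF THE CRUX, modulo the stubs of reshape 10.**  For the affine Weierstrass curve
`E_{A,B}` (`A, B` real algebraic) of a lattice `M` without complex multiplication, every `ℤ`-combination with vanishing value
of rational representations, first/second-kind elliptic cells and convergent tails on `E_{A,B}`, and TORSION CELLS
`∫_a^b P(x) dx / (∏ᵢ (x − cᵢ)^{mᵢ} √(x³ + Ax + B))` whose real poles `cᵢ ∉ [a, b]` are abscissae of torsion points of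
`E_{A,B}` — incomplete elliptic integrals of the third kind with torsion singular divisor — lies in
`M₁ = closure (1a ∪ 1b ∪ 2 ∪ Green)`.  Proof: `SectorGlue.realOnePeriodRelations_of_sector` with `torsCells`, `torsLayerArcs`
and `huberWustholzCurvePeriods_torsionPunctured`. [cite: HuberWustholz2022, Thm 13.3 (2), §13.2] [cite: KontsevichZagier2001, §1.2] -/
theorem realOnePeriodRelations_torsionLayer : ∀ (A B : ℝ), IsAlgebraic ℚ A → IsAlgebraic ℚ B →
    ∀ (M : PeriodPair), M.g₂ = -4 * (A : ℂ) → M.g₃ = -4 * (B : ℂ) → ¬ M.HasCM →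
    ∀ c : KZ.FormalRep, c ∈ AddSubgroup.closure ((fun r : KZ.IntegralRep 1 => KZ.of r) ''
      {r | r.IsRational ∨
        (∃ a b : ℝ, IsAlgebraic ℚ a ∧ IsAlgebraic ℚ b ∧ a < b ∧ r.domain = {z | z 0 ∈ Set.Ioo a b} ∧
          (∀ x ∈ Set.Ioo a b, 0 < x ^ 3 + A * x + B) ∧
          ∃ P₁ P₂ P₃ : Polynomial (algebraicClosure ℚ ℝ), ∀ x ∈ Set.Ioo a b,
            r.integrand (fun _ => x) = Polynomial.aeval x P₁ + Polynomial.aeval x P₂ * Real.sqrt (x ^ 3 + A * x + B) +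
              Polynomial.aeval x P₃ / Real.sqrt (x ^ 3 + A * x + B)) ∨
        (∃ e M' c₀ : ℝ, IsAlgebraic ℚ e ∧ IsAlgebraic ℚ M' ∧ IsAlgebraic ℚ c₀ ∧ e ^ 3 + A * e + B = 0 ∧
          0 < 3 * e ^ 2 + A ∧ e < M' ∧ (∀ x : ℝ, e < x → 0 < x ^ 3 + A * x + B) ∧ r.domain = {z | M' < z 0} ∧
          ∀ z ∈ r.domain, r.integrand z = c₀ / Real.sqrt ((z 0) ^ 3 + A * (z 0) + B)) ∨
        (∃ a b : ℝ, IsAlgebraic ℚ a ∧ IsAlgebraic ℚ b ∧ a < b ∧ r.domain = {z | z 0 ∈ Set.Ioo a b} ∧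
          (∀ x ∈ Set.Ioo a b, 0 < x ^ 3 + A * x + B) ∧
          ∃ (k : ℕ) (c : Fin k → ℝ) (m : Fin k → ℕ) (P : Polynomial (algebraicClosure ℚ ℝ)),
            (∀ i, IsAlgebraic ℚ (c i)) ∧ (∀ i, c i ∉ Set.Icc a b) ∧
            (∀ i, ∃ v : ℂ, v ∉ M.lattice ∧ (∃ n : ℕ, 1 ≤ n ∧ (n : ℂ) * v ∈ M.lattice) ∧ ℘[M] v = (c i : ℂ)) ∧
            ∀ x ∈ Set.Ioo a b, r.integrand (fun _ => x) =
              Polynomial.aeval x P / ((∏ i, (x - c i) ^ m i) * Real.sqrt (x ^ 3 + A * x + B)))}) →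
    KZ.eval c = 0 →
    c ∈ AddSubgroup.closure (KZ.domainAddRel ∪ KZ.integrandAddRel ∪ KZ.changeOfVariablesRel ∪
      {g : KZ.FormalRep | ∃ (Δ : Set (Fin 2 → ℝ)) (A B S : (Fin 2 → ℝ) → ℝ) (r₀₁ r₁₂ r₀₂ : KZ.IntegralRep 1),
        Δ = {p | 0 ≤ p 0 ∧ 0 ≤ p 1 ∧ p 0 + p 1 ≤ 1} ∧ IsSemialgebraicFunOn ℚ Δ A ∧ IsSemialgebraicFunOn ℚ Δ B ∧
        ContinuousOn A Δ ∧ ContinuousOn B Δ ∧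
        (∀ p : Fin 2 → ℝ, 0 < p 0 → 0 < p 1 → p 0 + p 1 < 1 →
          HasFDerivAt S (A p • ContinuousLinearMap.proj (R := ℝ) (φ := fun _ : Fin 2 => ℝ) 0 +
            B p • ContinuousLinearMap.proj (R := ℝ) (φ := fun _ : Fin 2 => ℝ) 1) p) ∧
        r₀₁.domain = {z | z 0 ∈ Set.Ioo 0 1} ∧ r₁₂.domain = {z | z 0 ∈ Set.Ioo 0 1} ∧
        r₀₂.domain = {z | z 0 ∈ Set.Ioo 0 1} ∧ (∀ z ∈ r₀₁.domain, r₀₁.integrand z = A ![z 0, 0]) ∧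
        (∀ z ∈ r₁₂.domain, r₁₂.integrand z = B ![1 - z 0, z 0] - A ![1 - z 0, z 0]) ∧
        (∀ z ∈ r₀₂.domain, r₀₂.integrand z = B ![0, z 0]) ∧ g = KZ.of r₀₁ + KZ.of r₁₂ - KZ.of r₀₂}) := by
  intro A B hA hB M hM₂ hM₃ hCM c hc heval
  change c ∈ M₁
  have hD : 4 * A ^ 3 + 27 * B ^ 2 ≠ 0 := by
    intro h
    apply M.discr_ne_zero
    rw [hM₂, hM₃]
    have h' : ((4 * A ^ 3 + 27 * B ^ 2 : ℝ) : ℂ) = 0 := by rw [h]; simp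
    push_cast at h'
    linear_combination (-16 : ℂ) * h'
  have hg₂ : IsAlgebraic ℚ M.g₂ := by rw [hM₂]; exact ((isAlgebraic_int 4).neg).mul hA.algebraMap
  have hg₃ : IsAlgebraic ℚ M.g₃ := by rw [hM₃]; exact ((isAlgebraic_int 4).neg).mul hB.algebraMap
  have hE : Ell.curve M = weierCurve (A : ℂ) (B : ℂ) := Ell.curve_eq_weierCurve hM₂ hM₃
  refine SectorGlue.realOnePeriodRelations_of_sector _ _ _ (fun C hCalg hCsupp hC0 => ?_)
    (torsCells A B hA hB M) (torsLayerArcs A B hA hB hD M hM₂ hM₃) c hc heval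
  refine huberWustholzCurvePeriods_torsionPunctured M hg₂ hg₃ hCM C hCalg (fun s hs => ?_) hC0
  rcases hCsupp s hs with hT | hP | hW
  · exact Or.inl hT
  · exact Or.inr (Or.inl hP)
  · exact Or.inr (Or.inr (Or.inl (hW.trans hE.symm)))

end Layer

end TorsionLayer

end Summit.KontsevichZagierPeriods.SymplecticScissors.RealOnePeriodRelations

end
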